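import Summits.AtomisticToContinuum.FouriersLaw.Theorems.BondHeatUncertaintyBoundedResponseBlockEnergyVarianceA
import HarnessLib

/-!
# BondHeatUncertainty / BoundedResponse — «BlockEnergyVariance» (W) (lens-1 g100 NODE 100W; critic rows 1414 R6 / 1417 (A)): part 2 of 2 (sequel of `…BlockEnergyVarianceA`, whose module docstring describes the node)

Split for the 400-line cap by the landing lane (hand-2 g37).  This part: §W.3 extensive variance of the block energies (`leftEnergy_variance_le`), §W.4 ★ `extensiveBlockEnergyVariance_holds : ExtensiveBlockEnergyVariance`,
§W.5 the now unconditional committor corner (★ `correctorGrade_one_iff_budget_three`, `correctorGrade_one_of_coneScale`, `kineticCorrectorBudget_of_coneScale`, `boundedResponse_of_leakPoint_coneScale`).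
Same namespace, section, opens and variables; all FQNs unchanged; bodies verbatim.  0 sorry; standard axioms.
-/

noncomputable section

open MeasureTheory ProbabilityTheory Finset Filter
open Literature.MathematicalPhysics.KineticTheory
open Literature.MathematicalPhysics.KineticTheory.HeatConduction
open Literature.MathematicalPhysics.KineticTheory.HeatConduction.HardTether

namespace Summit.AtomisticToContinuum.FouriersLaw.Theorems.BoundedResponse.ParityFloor

section BlockEnergyVariance

open BoundaryKubo.GibbsTtcf TransientContact
open Summit.AtomisticToContinuum.FouriersLaw.Theorems.SubdiffusiveBondHeat.EscapeGrading (CurrentCorrectorBudget)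
open Summit.AtomisticToContinuum.FouriersLaw.Theorems.SubdiffusiveBondHeat.CorrectorBudget (KineticCorrectorBudget)
open Summit.AtomisticToContinuum.FouriersLaw.Theses.OddSectorIrreversibility (ConeScaleCorrector)
open Summit.AtomisticToContinuum.FouriersLaw.Theses.BondHeatUncertainty (BoundedResponse)

variable {ω₂ lam β γ T : ℝ} {N : ℕ}

/-! ## §W.3 Extensive variance of the block energies -/

/-- **`Var_{μ_T}(E_{≤b}) ≤ (T² + (T/ω₂)K₁)·N`**, uniformly in the bond `b`: the (V)-argument for the block
(kinetic covariance `(T²/2)#{k ≤ b}` by `IncoherentBounded.integral_kinObs_mul_leftEnergy`, potential covariance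
`≤ ½Var + ½Var_w(U_{≤b})`, and §W.2).
[cite: BrascampLieb1976, Thm 4.1] -/
theorem leftEnergy_variance_le (hω : 0 < ω₂) (hl : 0 ≤ lam) (hβ : 0 < β) (hT : 0 < T) (b : Fin N) :
    Integrable (fun x => (leftEnergy (pinnedChain ω₂ lam β γ) N b x -
        ∫ y, leftEnergy (pinnedChain ω₂ lam β γ) N b y ∂((pinnedChain ω₂ lam β γ).gibbsMeasure N T)) ^ 2)
      ((pinnedChain ω₂ lam β γ).gibbsMeasure N T) ∧
    ∫ x, (leftEnergy (pinnedChain ω₂ lam β γ) N b x -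
        ∫ y, leftEnergy (pinnedChain ω₂ lam β γ) N b y ∂((pinnedChain ω₂ lam β γ).gibbsMeasure N T)) ^ 2
        ∂((pinnedChain ω₂ lam β γ).gibbsMeasure N T) ≤
      (T ^ 2 + T / ω₂ * (3 * gradConst ω₂ lam β * (1 + T / ω₂ + 90 * (T / ω₂) ^ 3))) * N := by
  set K₁ : ℝ := 3 * gradConst ω₂ lam β * (1 + T / ω₂ + 90 * (T / ω₂) ^ 3) with hK₁
  set P := pinnedChain ω₂ lam β γ with hP
  set μ := P.gibbsMeasure N T with hμ
  set E : PhaseSpace N → ℝ := leftEnergy P N b with hEdef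
  haveI : IsProbabilityMeasure μ := pinnedChain_isProbabilityMeasure_gibbsMeasure hω hl hβ.le γ N hT
  have hK₁0 : 0 ≤ K₁ := by
    have := gradConst_nonneg (ω₂ := ω₂) (lam := lam) (β := β)
    have := div_pos hT hω
    positivity
  set m : ℝ := ∫ x, E x ∂μ with hm
  obtain ⟨hϑ0, h2ϑ, hϑ1⟩ := weight_facts hT
  set ϑ : ℝ := 1 / (4 * T) with hϑ
  set U : (Fin N → ℝ) → ℝ := fun q => leftEnergy P N b (q, fun _ => 0) with hU
  set w : (Fin N → ℝ) → ℝ := potWeight ω₂ lam β T N with hw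
  set Z : ℝ := ∫ q, w q with hZ
  set mU : ℝ := (∫ q, U q * w q) / Z with hmU
  have hZ0 : 0 < Z := integral_potWeight_pos hω hl hβ.le hT
  -- pointwise facts
  have hH0 : ∀ x, 0 ≤ P.hamiltonian N x := fun x => pinnedChain_hamiltonian_nonneg hω.le hl hβ.le γ N x
  have hHc : Continuous (P.hamiltonian N) := pinnedChain_continuous_hamiltonian ω₂ lam β γ N
  have hHe : ∀ x, P.hamiltonian N x ≤ Real.exp (ϑ * P.hamiltonian N x) / ϑ := fun x =>
    IncoherentBounded.hamiltonian_le_exp (γ := γ) hϑ0 x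
  have hee : ∀ x, Real.exp (ϑ * P.hamiltonian N x) * Real.exp (ϑ * P.hamiltonian N x) =
      Real.exp (2 * ϑ * P.hamiltonian N x) := fun x => by rw [← Real.exp_add]; ring_nf
  have he1 : ∀ x, 1 ≤ Real.exp (ϑ * P.hamiltonian N x) := fun x =>
    Real.one_le_exp (mul_nonneg hϑ0.le (hH0 x))
  obtain ⟨hUq, hEx⟩ := leftEnergy_zero_nonneg_le (γ := γ) (N := N) hω.le hl hβ.le b
  have hE0 : ∀ x, 0 ≤ E x := fun x => (hEx x).1
  have hEH : ∀ x, E x ≤ P.hamiltonian N x := fun x => (hEx x).2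
  have hEc : Continuous E :=
    (contDiff_leftEnergy P (pinnedChain_contDiff_U ω₂ lam β γ (n := 1))
      (pinnedChain_contDiff_V ω₂ lam β γ (n := 1)) N b).continuous
  have hU0 : ∀ x : PhaseSpace N, 0 ≤ U x.1 := fun x => (hUq x.1).1
  have hUH : ∀ x : PhaseSpace N, U x.1 ≤ P.hamiltonian N x := fun x =>
    (hUq x.1).2.trans (potEnergy_fst_le_hamiltonian x)
  have hUc : Continuous fun x : PhaseSpace N => U x.1 - mU := by
    have hc : Continuous U := hEc.comp (by fun_prop)
    exact (hc.comp continuous_fst).sub continuous_const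
  have hUb : ∀ x : PhaseSpace N, |U x.1 - mU| ≤ (1 / ϑ + |mU|) * Real.exp (ϑ * P.hamiltonian N x) :=
    fun x => by
    calc |U x.1 - mU| ≤ |U x.1| + |mU| := abs_sub _ _
      _ = U x.1 + |mU| := by rw [abs_of_nonneg (hU0 x)]
      _ ≤ Real.exp (ϑ * P.hamiltonian N x) / ϑ + |mU| * Real.exp (ϑ * P.hamiltonian N x) :=
          add_le_add ((hUH x).trans (hHe x)) (le_mul_of_one_le_right (abs_nonneg _) (he1 x))
      _ = _ := by ring
  have hEmc : Continuous fun x => E x - m := hEc.sub continuous_const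
  have hEm_b : ∀ x : PhaseSpace N, |E x - m| ≤ (1 / ϑ + |m|) * Real.exp (ϑ * P.hamiltonian N x) :=
    fun x => by
    calc |E x - m| ≤ |E x| + |m| := abs_sub _ _
      _ = E x + |m| := by rw [abs_of_nonneg (hE0 x)]
      _ ≤ Real.exp (ϑ * P.hamiltonian N x) / ϑ + |m| * Real.exp (ϑ * P.hamiltonian N x) :=
          add_le_add ((hEH x).trans (hHe x)) (le_mul_of_one_le_right (abs_nonneg _) (he1 x))
      _ = _ := by ring
  have hθc : ∀ i, Continuous (kinObs T N i) := fun i => continuous_kinObs T i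
  have hθb : ∀ i x, |kinObs T N i x| ≤ (2 / ϑ + T) * Real.exp (ϑ * P.hamiltonian N x) := fun i x =>
    abs_kinObs_le (γ := γ) hω hl hβ.le hT.le hϑ0 i x
  -- integrability on μ
  have iE : Integrable E μ :=
    integrable_gibbs_of_abs_le hω hl hβ.le hT hϑ1 hEc (A := 1 / ϑ) (fun x => by
      rw [abs_of_nonneg (hE0 x)]; have := (hEH x).trans (hHe x); rw [div_eq_inv_mul] at this
      simpa [one_div] using this)
  have iθ : ∀ i, Integrable (kinObs T N i) μ := fun i =>
    integrable_gibbs_of_abs_le hω hl hβ.le hT hϑ1 (hθc i) (hθb i)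
  have iθE : ∀ i, Integrable (fun x => kinObs T N i x * E x) μ := fun i =>
    integrable_gibbs_of_abs_le hω hl hβ.le hT h2ϑ ((hθc i).mul hEc) (A := (2 / ϑ + T) * (1 / ϑ))
      (fun x => by
        rw [abs_mul, abs_of_nonneg (hE0 x)]
        calc |kinObs T N i x| * E x
            ≤ (2 / ϑ + T) * Real.exp (ϑ * P.hamiltonian N x) * (Real.exp (ϑ * P.hamiltonian N x) / ϑ) :=
              mul_le_mul (hθb i x) ((hEH x).trans (hHe x)) (hE0 x) (by positivity)
          _ = (2 / ϑ + T) * (1 / ϑ) * Real.exp (2 * ϑ * P.hamiltonian N x) := by rw [← hee x]; ring)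
  have iEθ : ∀ i, Integrable (fun x => (E x - m) * kinObs T N i x) μ := fun i =>
    integrable_gibbs_of_abs_le hω hl hβ.le hT h2ϑ (hEmc.mul (hθc i)) (A := (1 / ϑ + |m|) * (2 / ϑ + T))
      (fun x => by
        rw [abs_mul]
        calc |E x - m| * |kinObs T N i x|
            ≤ (1 / ϑ + |m|) * Real.exp (ϑ * P.hamiltonian N x) * ((2 / ϑ + T) * Real.exp (ϑ * P.hamiltonian N x)) :=
              mul_le_mul (hEm_b x) (hθb i x) (abs_nonneg _) (by positivity)
          _ = (1 / ϑ + |m|) * (2 / ϑ + T) * Real.exp (2 * ϑ * P.hamiltonian N x) := by rw [← hee x]; ring)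
  have iEU : Integrable (fun x => (E x - m) * (U x.1 - mU)) μ :=
    integrable_gibbs_of_abs_le hω hl hβ.le hT h2ϑ (hEmc.mul hUc) (A := (1 / ϑ + |m|) * (1 / ϑ + |mU|))
      (fun x => by
        rw [abs_mul]
        calc |E x - m| * |U x.1 - mU|
            ≤ (1 / ϑ + |m|) * Real.exp (ϑ * P.hamiltonian N x) * ((1 / ϑ + |mU|) * Real.exp (ϑ * P.hamiltonian N x)) :=
              mul_le_mul (hEm_b x) (hUb x) (abs_nonneg _) (by positivity)
          _ = (1 / ϑ + |m|) * (1 / ϑ + |mU|) * Real.exp (2 * ϑ * P.hamiltonian N x) := by rw [← hee x]; ring)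
  have iU_sq : Integrable (fun x : PhaseSpace N => (U x.1 - mU) ^ 2) μ :=
    integrable_gibbs_of_abs_le hω hl hβ.le hT h2ϑ (hUc.pow 2) (A := (1 / ϑ + |mU|) ^ 2)
      (fun x => by
        rw [abs_of_nonneg (sq_nonneg _), ← sq_abs]
        calc |U x.1 - mU| ^ 2 ≤ ((1 / ϑ + |mU|) * Real.exp (ϑ * P.hamiltonian N x)) ^ 2 :=
              pow_le_pow_left₀ (abs_nonneg _) (hUb x) 2
          _ = (1 / ϑ + |mU|) ^ 2 * Real.exp (2 * ϑ * P.hamiltonian N x) := by rw [← hee x]; ring)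
  have iEm_sq : Integrable (fun x : PhaseSpace N => (E x - m) ^ 2) μ :=
    integrable_gibbs_of_abs_le hω hl hβ.le hT h2ϑ (hEmc.pow 2) (A := (1 / ϑ + |m|) ^ 2)
      (fun x => by
        rw [abs_of_nonneg (sq_nonneg _), ← sq_abs]
        calc |E x - m| ^ 2 ≤ ((1 / ϑ + |m|) * Real.exp (ϑ * P.hamiltonian N x)) ^ 2 :=
              pow_le_pow_left₀ (abs_nonneg _) (hEm_b x) 2
          _ = (1 / ϑ + |m|) ^ 2 * Real.exp (2 * ϑ * P.hamiltonian N x) := by rw [← hee x]; ring)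
  -- the split `E − m = (∑ [k ≤ b] θₖ)/2 + (U − c)`, `c = m − (∑ [k ≤ b]) T/2`
  have hsplit : ∀ x, E x - m =
      (∑ k, blockWeight b k * kinObs T N k x) / 2 + (U x.1 - (m - (∑ k, blockWeight b k) * T / 2)) := fun x => by
    rw [hEdef, leftEnergy_eq_kin_add_zero]
    simp only [hU, kinObs, mul_sub, Finset.sum_sub_distrib, ← Finset.sum_mul]
    have e : ∑ k, blockWeight b k * (x.2 k ^ 2 / 2) = (∑ k, blockWeight b k * x.2 k ^ 2) / 2 := by
      rw [Finset.sum_div]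
      exact Finset.sum_congr rfl fun k _ => by ring
    rw [e]
    ring
  -- ∫ (E − m) = 0
  have iEm : Integrable (fun x => E x - m) μ := iE.sub (integrable_const m)
  have hEm0 : ∫ x, (E x - m) ∂μ = 0 := by
    rw [integral_sub iE (integrable_const m), integral_const, probReal_univ, one_smul, hm]
    simp
  -- the product split, pointwise
  have hprod : ∀ x, (E x - m) * ((∑ k, blockWeight b k * kinObs T N k x) / 2) =
      (1 / 2) * ∑ k, blockWeight b k * ((E x - m) * kinObs T N k x) := fun x => by
    rw [Finset.sum_div, Finset.mul_sum, Finset.mul_sum]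
    exact Finset.sum_congr rfl fun k _ => by ring
  -- I₁: the kinetic covariance
  have hI1 : ∀ k, ∫ x, (E x - m) * kinObs T N k x ∂μ = blockWeight b k * T ^ 2 := fun k => by
    have e : ∀ x, (E x - m) * kinObs T N k x = kinObs T N k x * E x - m * kinObs T N k x := fun x => by ring
    simp_rw [e]
    rw [integral_sub (iθE k) ((iθ k).const_mul m), integral_const_mul]
    have h1 : ∫ x, kinObs T N k x * E x ∂μ = blockWeight b k * T ^ 2 :=
      IncoherentBounded.integral_kinObs_mul_leftEnergy hω hl hβ hT b k
    have h2 : ∫ x, kinObs T N k x ∂μ = 0 := integral_kinObs hω hl hβ.le hT k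
    rw [h1, h2, mul_zero, sub_zero]
  have hI1s : ∫ x, (E x - m) * ((∑ k, blockWeight b k * kinObs T N k x) / 2) ∂μ ≤ N * T ^ 2 / 2 := by
    simp_rw [hprod]
    rw [integral_const_mul, integral_finsetSum _ (fun k _ => (iEθ k).const_mul _)]
    simp only [integral_const_mul, hI1]
    have hle : ∀ k, blockWeight b k * (blockWeight b k * T ^ 2) ≤ T ^ 2 := fun k => by
      have hw := blockWeight_nonneg_le_one b k
      nlinarith [hw.1, hw.2, sq_nonneg T, mul_le_mul_of_nonneg_right hw.2 (sq_nonneg T)]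
    have hs : ∑ k : Fin N, blockWeight b k * (blockWeight b k * T ^ 2) ≤ ∑ _k : Fin N, T ^ 2 :=
      Finset.sum_le_sum fun k _ => hle k
    rw [Finset.sum_const, Finset.card_univ, Fintype.card_fin, nsmul_eq_mul] at hs
    linarith
  -- I₂: the potential covariance, `≤ ½ Var E + ½ Var U`
  have hI2 : ∫ x, (E x - m) * (U x.1 - (m - (∑ k, blockWeight b k) * T / 2)) ∂μ =
      ∫ x, (E x - m) * (U x.1 - mU) ∂μ := by
    have e : ∀ x, (E x - m) * (U x.1 - (m - (∑ k, blockWeight b k) * T / 2)) =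
        (E x - m) * (U x.1 - mU) + (mU - (m - (∑ k, blockWeight b k) * T / 2)) * (E x - m) := fun x => by
      ring
    simp_rw [e]
    rw [integral_add iEU (iEm.const_mul _), integral_const_mul, hEm0, mul_zero, add_zero]
  have hI2le : ∫ x, (E x - m) * (U x.1 - mU) ∂μ ≤
      (∫ x, (E x - m) ^ 2 ∂μ) / 2 + (∫ x, (U x.1 - mU) ^ 2 ∂μ) / 2 := by
    have hle : ∀ x, (E x - m) * (U x.1 - mU) ≤ ((E x - m) ^ 2 + (U x.1 - mU) ^ 2) / 2 := fun x => by
      nlinarith [sq_nonneg ((E x - m) - (U x.1 - mU))]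
    have iS0 : Integrable (fun x => (E x - m) ^ 2 + (U x.1 - mU) ^ 2) μ := iEm_sq.add iU_sq
    have iS : Integrable (fun x => ((E x - m) ^ 2 + (U x.1 - mU) ^ 2) / 2) μ := iS0.div_const 2
    have hS : ∫ x, ((E x - m) ^ 2 + (U x.1 - mU) ^ 2) / 2 ∂μ =
        (∫ x, (E x - m) ^ 2 ∂μ) / 2 + (∫ x, (U x.1 - mU) ^ 2 ∂μ) / 2 := by
      rw [integral_div, integral_add iEm_sq iU_sq, add_div]
    exact (integral_mono iEU iS hle).trans_eq hS
  -- Var E = I₁ + I₂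
  have hVar : ∫ x, (E x - m) ^ 2 ∂μ =
      (∫ x, (E x - m) * ((∑ k, blockWeight b k * kinObs T N k x) / 2) ∂μ) +
        ∫ x, (E x - m) * (U x.1 - mU) ∂μ := by
    have e : ∀ x, (E x - m) ^ 2 =
        (E x - m) * ((∑ k, blockWeight b k * kinObs T N k x) / 2) +
          (E x - m) * (U x.1 - (m - (∑ k, blockWeight b k) * T / 2)) := fun x => by
      conv_lhs => rw [sq, hsplit x]
      rw [hsplit x]
      ring
    have iA : Integrable (fun x => (E x - m) * ((∑ k, blockWeight b k * kinObs T N k x) / 2)) μ := by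
      have := (integrable_finsetSum (Finset.univ : Finset (Fin N))
        (fun k _ => (iEθ k).const_mul (blockWeight b k))).const_mul (1 / 2)
      exact this.congr (Eventually.of_forall fun x => (hprod x).symm)
    have iB : Integrable (fun x => (E x - m) * (U x.1 - (m - (∑ k, blockWeight b k) * T / 2))) μ := by
      have := iEU.add (iEm.const_mul (mU - (m - (∑ k, blockWeight b k) * T / 2)))
      refine this.congr (Eventually.of_forall fun x => ?_)
      simp only [Pi.add_apply]
      ring
    simp_rw [e]
    rw [integral_add iA iB, hI2]
  -- Var(U∘fst) via the q-marginal and `leftPotFluct_le`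
  have hVarU : ∫ x, (U x.1 - mU) ^ 2 ∂μ ≤ T / ω₂ * ((N : ℝ) * K₁) := by
    rw [hμ, hP, integral_comp_fst_gibbsMeasure hT (fun q => (U q - mU) ^ 2), div_le_iff₀ hZ0]
    have := leftPotFluct_le (N := N) (γ := γ) hω hl hβ.le hT b
    rw [← hP, ← hw, ← hZ] at this
    change ∫ q, (U q - (∫ q, U q * w q) / Z) ^ 2 * w q ≤ T / ω₂ * ((N : ℝ) * K₁ * Z) at this
    rw [← hmU] at this
    linarith [this]
  -- conclusion
  refine ⟨iEm_sq, ?_⟩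
  have hfin : ∫ x, (E x - m) ^ 2 ∂μ ≤ N * T ^ 2 + T / ω₂ * ((N : ℝ) * K₁) := by
    linarith [hVar, hI1s, hI2le, hVarU]
  calc ∫ x, (E x - m) ^ 2 ∂μ ≤ N * T ^ 2 + T / ω₂ * ((N : ℝ) * K₁) := hfin
    _ = (T ^ 2 + T / ω₂ * K₁) * N := by ring

/-! ## §W.4 `(W)` holds -/

/-- A continuous observable with `0 ≤ g ≤ H` is in `L²(μ_T)` (`H² ≤ e^{2ϑH}/ϑ²`, `ϑ = 1/(4T)`). [folklore] -/
theorem memLp_two_of_nonneg_le_hamiltonian (hω : 0 < ω₂) (hl : 0 ≤ lam) (hβ : 0 ≤ β) (hT : 0 < T)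
    {g : PhaseSpace N → ℝ} (hg : Continuous g) (h0 : ∀ x, 0 ≤ g x)
    (hH : ∀ x, g x ≤ (pinnedChain ω₂ lam β γ).hamiltonian N x) :
    MemLp g 2 ((pinnedChain ω₂ lam β γ).gibbsMeasure N T) := by
  obtain ⟨hϑ0, h2ϑ, -⟩ := weight_facts hT
  set ϑ : ℝ := 1 / (4 * T) with hϑ
  rw [memLp_two_iff_integrable_sq hg.aestronglyMeasurable]
  refine integrable_gibbs_of_abs_le hω hl hβ hT h2ϑ (hg.pow 2) (A := 1 / ϑ ^ 2) fun x => ?_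
  have hHe : (pinnedChain ω₂ lam β γ).hamiltonian N x ≤
      Real.exp (ϑ * (pinnedChain ω₂ lam β γ).hamiltonian N x) / ϑ :=
    IncoherentBounded.hamiltonian_le_exp (γ := γ) hϑ0 x
  have hee : Real.exp (ϑ * (pinnedChain ω₂ lam β γ).hamiltonian N x) *
      Real.exp (ϑ * (pinnedChain ω₂ lam β γ).hamiltonian N x) =
      Real.exp (2 * ϑ * (pinnedChain ω₂ lam β γ).hamiltonian N x) := by rw [← Real.exp_add]; ring_nf
  rw [abs_of_nonneg (sq_nonneg _)]
  calc g x ^ 2 ≤ ((pinnedChain ω₂ lam β γ).hamiltonian N x) ^ 2 := pow_le_pow_left₀ (h0 x) (hH x) 2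
    _ ≤ (Real.exp (ϑ * (pinnedChain ω₂ lam β γ).hamiltonian N x) / ϑ) ^ 2 :=
        pow_le_pow_left₀ ((h0 x).trans (hH x)) hHe 2
    _ = 1 / ϑ ^ 2 * Real.exp (2 * ϑ * (pinnedChain ω₂ lam β γ).hamiltonian N x) := by
        rw [div_pow, sq (Real.exp _), hee]; ring

/-- **(W) `ExtensiveBlockEnergyVariance` holds**, with `C = 2C_H + 2(T² + (T/ω₂)K₁)`:
`E_{≤b}, E_{>b} ∈ L²(μ_T)`, `Var(E_{≤b}) ≤ (T² + (T/ω₂)K₁)N` (`leftEnergy_variance_le`) and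
`Var(E_{>b}) = Var(H − E_{≤b}) ≤ 2Var H + 2Var E_{≤b}` with (V) `energyFluctuationExtensive_holds`.
[cite: BrascampLieb1976, Thm 4.1] -/
theorem extensiveBlockEnergyVariance_holds : ExtensiveBlockEnergyVariance := by
  intro ω₂ lam β γ hω hl hβ hγ T hT
  obtain ⟨CH, hCH⟩ := energyFluctuationExtensive_holds ω₂ lam β γ hω hl hβ hγ T hT
  set K₁ : ℝ := 3 * gradConst ω₂ lam β * (1 + T / ω₂ + 90 * (T / ω₂) ^ 3) with hK₁
  set CV : ℝ := T ^ 2 + T / ω₂ * K₁ with hCV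
  have hK₁0 : 0 ≤ K₁ := by
    have := gradConst_nonneg (ω₂ := ω₂) (lam := lam) (β := β)
    have := div_pos hT hω
    positivity
  have hCV0 : 0 ≤ CV := by have := div_pos hT hω; positivity
  have hCH0 : 0 ≤ CH := by
    have h := hCH 1
    have h0 : (0 : ℝ) ≤ ∫ z, ((pinnedChain ω₂ lam β γ).hamiltonian 1 z -
        ∫ x, (pinnedChain ω₂ lam β γ).hamiltonian 1 x ∂((pinnedChain ω₂ lam β γ).gibbsMeasure 1 T)) ^ 2
          ∂((pinnedChain ω₂ lam β γ).gibbsMeasure 1 T) := integral_nonneg fun _ => sq_nonneg _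
    have := h0.trans h
    simpa using this
  refine ⟨2 * CH + 2 * CV, fun N b hb => ?_⟩
  set P := pinnedChain ω₂ lam β γ with hP
  set μ := P.gibbsMeasure N T with hμ
  haveI : IsProbabilityMeasure μ := pinnedChain_isProbabilityMeasure_gibbsMeasure hω hl.le hβ.le γ N hT
  have hN : 0 < N := by omega
  set bF : Fin N := ⟨b, by omega⟩ with hbF
  have hEq : blockEnergyLeft P N b = leftEnergy P N bF := blockEnergyLeft_eq_leftEnergy P bF
  set E : PhaseSpace N → ℝ := leftEnergy P N bF with hEdef
  set H : PhaseSpace N → ℝ := P.hamiltonian N with hHdef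
  have hR : blockEnergyRight P N b = fun x => H x - E x := by
    funext x
    show P.hamiltonian N x - blockEnergyLeft P N b x = H x - E x
    rw [hEq]
  -- pointwise facts and `L²`
  have hH0 : ∀ x, 0 ≤ H x := fun x => pinnedChain_hamiltonian_nonneg hω.le hl.le hβ.le γ N x
  have hHc : Continuous H := pinnedChain_continuous_hamiltonian ω₂ lam β γ N
  obtain ⟨-, hEx⟩ := leftEnergy_zero_nonneg_le (γ := γ) (N := N) hω.le hl.le hβ.le bF
  have hE0 : ∀ x, 0 ≤ E x := fun x => (hEx x).1
  have hEH : ∀ x, E x ≤ H x := fun x => (hEx x).2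
  have hEc : Continuous E :=
    (contDiff_leftEnergy P (pinnedChain_contDiff_U ω₂ lam β γ (n := 1))
      (pinnedChain_contDiff_V ω₂ lam β γ (n := 1)) N bF).continuous
  have hmemE : MemLp E 2 μ := memLp_two_of_nonneg_le_hamiltonian hω hl.le hβ.le hT hEc hE0 hEH
  have hmemH : MemLp H 2 μ := memLp_two_of_nonneg_le_hamiltonian hω hl.le hβ.le hT hHc hH0 (fun _ => le_rfl)
  have hmemR : MemLp (fun x => H x - E x) 2 μ := hmemH.sub hmemE
  -- the variances as integrals
  set mE : ℝ := ∫ x, E x ∂μ with hmE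
  set mH : ℝ := ∫ x, H x ∂μ with hmH
  obtain ⟨iVarE, hVarE⟩ := leftEnergy_variance_le hω hl.le hβ hT bF
  rw [← hP, ← hμ] at iVarE hVarE
  change Integrable (fun x => (E x - mE) ^ 2) μ at iVarE
  change ∫ x, (E x - mE) ^ 2 ∂μ ≤ CV * N at hVarE
  have hVarH : ∫ x, (H x - mH) ^ 2 ∂μ ≤ CH * N := hCH N
  have iVarH : Integrable (fun x => (H x - mH) ^ 2) μ := (hmemH.sub (memLp_const mH)).integrable_sq
  have iHE : Integrable (fun x => H x - E x) μ := hmemR.integrable one_le_two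
  have hmR : ∫ x, (H x - E x) ∂μ = mH - mE := integral_sub (hmemH.integrable one_le_two)
    (hmemE.integrable one_le_two)
  have iVarR : Integrable (fun x => ((H x - E x) - (mH - mE)) ^ 2) μ :=
    (hmemR.sub (memLp_const _)).integrable_sq
  have hVarR : ∫ x, ((H x - E x) - (mH - mE)) ^ 2 ∂μ ≤ 2 * (CH * N) + 2 * (CV * N) := by
    have hle : ∀ x, ((H x - E x) - (mH - mE)) ^ 2 ≤ 2 * (H x - mH) ^ 2 + 2 * (E x - mE) ^ 2 := fun x => by
      nlinarith [sq_nonneg ((H x - mH) + (E x - mE))]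
    have iS : Integrable (fun x => 2 * (H x - mH) ^ 2 + 2 * (E x - mE) ^ 2) μ :=
      (iVarH.const_mul 2).add (iVarE.const_mul 2)
    calc ∫ x, ((H x - E x) - (mH - mE)) ^ 2 ∂μ ≤ ∫ x, (2 * (H x - mH) ^ 2 + 2 * (E x - mE) ^ 2) ∂μ :=
          integral_mono iVarR iS hle
      _ = 2 * ∫ x, (H x - mH) ^ 2 ∂μ + 2 * ∫ x, (E x - mE) ^ 2 ∂μ := by
          rw [integral_add (iVarH.const_mul 2) (iVarE.const_mul 2), integral_const_mul, integral_const_mul]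
      _ ≤ 2 * (CH * N) + 2 * (CV * N) := by linarith [hVarH, hVarE]
  have hNn : (0 : ℝ) ≤ N := Nat.cast_nonneg N
  refine ⟨by rw [hEq]; exact hmemE, by rw [hR]; exact hmemR, ?_, ?_⟩
  · unfold blockEnergyLeftVar
    rw [hEq, ← hμ, variance_eq_integral hEc.aemeasurable]
    change ∫ x, (E x - mE) ^ 2 ∂μ ≤ (2 * CH + 2 * CV) * N
    nlinarith [hVarE, hCH0, hCV0, hNn]
  · unfold blockEnergyRightVar
    rw [hR, ← hμ, variance_eq_integral (X := fun x => H x - E x) (hHc.sub hEc).aemeasurable]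
    change ∫ x, ((H x - E x) - ∫ y, (H y - E y) ∂μ) ^ 2 ∂μ ≤ (2 * CH + 2 * CV) * N
    rw [hmR]
    linarith [hVarR]

/-! ## §W.5 Consequences: the committor corner is unconditional -/

/-- ★ **(C₁) ⟺ CCB(3), outright.** The corrector grade `CorrectorGrade 1` (`‖h₀‖²_{L²(μ_{N,T})} = O(N)`) IS the
rung `a = 3` of the current-corrector ladder `CurrentCorrectorBudget` (`∫ u_N² d(e^{−H/T}dx) ≤ C N³ Z`):
`…CommittorCorner.correctorGrade_one_iff_currentCorrectorBudget_three` with its only hypothesis (W) discharged by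
`extensiveBlockEnergyVariance_holds`. [folklore] -/
theorem correctorGrade_one_iff_budget_three : CorrectorGrade 1 ↔ CurrentCorrectorBudget 3 :=
  correctorGrade_one_iff_currentCorrectorBudget_three extensiveBlockEnergyVariance_holds

/-- ★ **E1 ⟹ (C₁), outright**: the sibling route's crux `ConeScaleCorrector` (stmt-14069, `= CCB(2)`) implies the
corrector grade. [folklore] -/
theorem correctorGrade_one_of_coneScale (hE : ConeScaleCorrector) : CorrectorGrade 1 :=
  correctorGrade_one_of_coneScaleCorrector extensiveBlockEnergyVariance_holds hE

/-- `KineticCorrectorBudget` (stmt-33857) from E1 alone. [formal bookkeeping] -/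
theorem kineticCorrectorBudget_of_coneScale (hE : ConeScaleCorrector) : KineticCorrectorBudget :=
  kineticCorrectorBudget_of_coneScaleCorrector extensiveBlockEnergyVariance_holds hE

/-- **11071 ⟸ (D_F) ∧ E1**: `BoundedResponse` from the leak point (D_F) `LeakPoint` and the cone-scale corrector
bound E1 `ConeScaleCorrector` — door v6 with its `N`-uniform leg supplied by E1, no static hypothesis left.
[formal bookkeeping] -/
theorem boundedResponse_of_leakPoint_coneScale (hF : LeakPoint) (hE : ConeScaleCorrector) : BoundedResponse :=
  boundedResponse_of_leakPoint_coneScaleCorrector extensiveBlockEnergyVariance_holds hF hE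

end BlockEnergyVariance

end Summit.AtomisticToContinuum.FouriersLaw.Theorems.BoundedResponse.ParityFloor

end
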